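import Summits.QuantumFields.YangMills.Theorems.LuscherReductionTwistedTraceScalingBTCoreFloor
import Summits.QuantumFields.YangMills.Theorems.LuscherReductionTwistedTraceScalingBTDiagonalIntegral
import HarnessLib

/-!
# Gaussian domination of the reference density `ρ₁ = fpTriple β Ω W 1 1 / K₁(1,1)` by `F·e^{−β·kinDefect}` (upper, everywhere), its floor on the core box, and the upper
# domination of the diagonal density at a slow datum `w` (magnetic remainder kept) — the pointwise inputs of the log-free layer cake
# (route `FlatTubeReduction`, crux K1 `NearFlatRatioLaw` stmt-QuantumFields-24720; seat `ym-line-ftr-p1` g12; rate twin «ratepack-v3 / frozen fibres»; R2b1 RECORD rung — no summit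
# statement is proved here)

WHY (memo `Cruxes/NearFlatRatioLaw/Lines/ratepack-v3-frozen-g12.md` §§5.6–5.7, brick (iv-a)).  `…GaussianLayerCake.moment_ratio_le_of_volume_growth_floorSet` wants `0 ≤ ρ ≤ C₁e^{−N}`
everywhere and `ρ ≥ c₁` on a floor set; `…DiagonalMomentSandwichCore` wants the tail masses of `ρ₁` and of `ρ_w = fpTriple(w,w)/K₁(w,w)` above a level of `N = β·kinDefect`.  All three
pointwise bounds are divisions of RED lane A's exact kernel identities (`transferKernel_gaugeTransform_eq`, `transferKernel_one_site_one_one_cube`, `transferKernel_constLift_self`,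
`transferKernel_orthoTube_one_ge`, `wilsonAction_orthoTube_ge`) — no new analysis:
* ★ `fpTriple_one_one_div_le` — `ρ₁(p) ≤ Ω(v̂)W(g)Ω(v̂′)·e^{−β·kinDefect(oT 1 v, oT 1 v′, g)}` for all `p` (`S ≥ 0` dropped, `K₁(1,1) = e^{2β|E|}`);
* ★ `fpTriple_one_one_div_ge` — on balanced capped fibres with `|v_{e,c}| ≤ t ≤ 1/30` and `g ∈ G_c(ρ)`: `ρ₁(p) ≥ Ω W Ω·exp(−β|E|(2ρ + √2‖v̂‖ + √2‖v̂′‖)² − (β/2)(100N_P(‖v̂‖² + ‖v̂′‖²) + 2E(t,0)))`;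
* ★ `fpTriple_diag_div_le` — at a slow datum `w` with `L³S₁(w) ≤ σ < 2`, `|v_{e,c}|, |v′_{e,c}| ≤ τ ≤ 1/30`: `ρ_w(p) ≤ Ω W Ω·e^{−β·kinDefect(oT w v, oT w v′, g) + β·E(τ,σ)}` (the slow
  magnetic action `L³S₁(w)` cancels EXACTLY against `K₁(w,w)`; only the cubic remainder `βE(τ,σ) → 0` survives).
HONEST FRAMING: bookkeeping of landed identities; femto rung R2b1 (RECORD label); not infinite volume, not a gap, not Clay.  No defs, no named facts, no `sorry`.
-/

set_option autoImplicit false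

noncomputable section

open MeasureTheory Filter Topology Real
open scoped BigOperators
open Literature.MathematicalPhysics.QuantumFieldTheory
open Literature.MathematicalPhysics.QuantumLattice

namespace Summit.QuantumFields.YangMills.Theorems.FemtoTransferGap.RateTube

open Summit.QuantumFields.YangMills.Theorems.FemtoTransferGap
open Summit.QuantumFields.YangMills.Theorems.FemtoTransferGap.TwoLattice
open Summit.QuantumFields.YangMills.Theorems.FemtoTransferGap.TwoLattice.ConstTube
open Summit.QuantumFields.YangMills.Theorems.FemtoTransferGap.TwoLattice.Avg
open Summit.QuantumFields.YangMills.Theorems.FemtoTransferGap.TwoLattice.Cov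
open Summit.QuantumFields.YangMills.Theorems.FemtoTransferGap.TwoLattice.Stiff (LinkSpace)

variable {L : ℕ} [NeZero L]

/-! ## §1 ★ Upper Gaussian domination of the reference density, everywhere -/

/-- ★ **`ρ₁ ≤ F·e^{−β·kinDefect}`**: for `β ≥ 0`, `Ω, W ≥ 0` and every fibre/gauge datum `p = (v, v′, g)`,
`fpTriple β Ω W 1 1 p / K₁^{(L³β)}(1,1) ≤ Ω(v̂)·W(g)·Ω(v̂′)·exp(−β·kinDefect (oT 1 v) (oT 1 v′) g)`. [cite: Luscher1983, §3] -/
theorem fpTriple_one_one_div_le {β : ℝ} (hβ : 0 ≤ β) {Ω : LinkSpace L → ℝ} (hΩ0 : ∀ x, 0 ≤ Ω x) {W : (Site 3 L → SU2) → ℝ} (hW0 : ∀ g, 0 ≤ W g)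
    (p : (Edge 3 L → Fin 3 → ℝ) × ((Edge 3 L → Fin 3 → ℝ) × (Site 3 L → SU2))) :
    fpTriple L β Ω W 1 1 p / transferKernel su2Rep ((L : ℝ) ^ 3 * β) (1 : GaugeConfig 3 1 SU2) 1 ≤
      Ω (linkEmbed L p.1) * (W p.2.2 * Ω (linkEmbed L p.2.1)) * Real.exp (-(β * kinDefect L (orthoTube L 1 p.1) (orthoTube L 1 p.2.1) p.2.2)) := by
  have hK := transferKernel_gaugeTransform_le hβ (orthoTube L 1 p.1) (orthoTube L 1 p.2.1) p.2.2
  have hK1 := transferKernel_one_site_one_one_cube (L := L) β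
  have hK1p : 0 < transferKernel su2Rep ((L : ℝ) ^ 3 * β) (1 : GaugeConfig 3 1 SU2) 1 := transferKernel_pos _ _ _ _
  have hratio : transferKernel su2Rep β (orthoTube L 1 p.1) (gaugeTransform p.2.2 (orthoTube L 1 p.2.1)) / transferKernel su2Rep ((L : ℝ) ^ 3 * β) (1 : GaugeConfig 3 1 SU2) 1 ≤
      Real.exp (-(β * kinDefect L (orthoTube L 1 p.1) (orthoTube L 1 p.2.1) p.2.2)) := by
    rw [div_le_iff₀ hK1p, hK1, ← Real.exp_add]
    refine hK.trans (Real.exp_le_exp.mpr (le_of_eq ?_))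
    ring
  unfold fpTriple
  have hF : 0 ≤ Ω (linkEmbed L p.1) * (W p.2.2 * Ω (linkEmbed L p.2.1)) := mul_nonneg (hΩ0 _) (mul_nonneg (hW0 _) (hΩ0 _))
  calc Ω (linkEmbed L p.1) * (W p.2.2 * transferKernel su2Rep β (orthoTube L 1 p.1) (gaugeTransform p.2.2 (orthoTube L 1 p.2.1)) * Ω (linkEmbed L p.2.1)) /
        transferKernel su2Rep ((L : ℝ) ^ 3 * β) (1 : GaugeConfig 3 1 SU2) 1 =
      Ω (linkEmbed L p.1) * (W p.2.2 * Ω (linkEmbed L p.2.1)) *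
        (transferKernel su2Rep β (orthoTube L 1 p.1) (gaugeTransform p.2.2 (orthoTube L 1 p.2.1)) / transferKernel su2Rep ((L : ℝ) ^ 3 * β) (1 : GaugeConfig 3 1 SU2) 1) := by ring
    _ ≤ Ω (linkEmbed L p.1) * (W p.2.2 * Ω (linkEmbed L p.2.1)) * Real.exp (-(β * kinDefect L (orthoTube L 1 p.1) (orthoTube L 1 p.2.1) p.2.2)) :=
      mul_le_mul_of_nonneg_left hratio hF

/-! ## §2 ★ The floor of the reference density on the core box -/

/-- ★ **`ρ₁ ≥ F·e^{−(explicit)}` on the core box**: balanced capped fibres with `|v_{e,c}|, |v′_{e,c}| ≤ t ≤ 1/30`, `g ∈ G_c(ρ)`, `β ≥ 0`, `Ω, W ≥ 0` ⇒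
`fpTriple β Ω W 1 1 p / K₁(1,1) ≥ Ω W Ω·exp(−β|E|(2ρ + √2‖v̂‖ + √2‖v̂′‖)² − (β/2)((10√N_P‖v̂‖)² + E(t,0) + (10√N_P‖v̂′‖)² + E(t,0)))`. [cite: Luscher1983, §3] -/
theorem fpTriple_one_one_div_ge {β : ℝ} (hβ : 0 ≤ β) {Ω : LinkSpace L → ℝ} (hΩ0 : ∀ x, 0 ≤ Ω x) {W : (Site 3 L → SU2) → ℝ} (hW0 : ∀ g, 0 ≤ W g)
    {v v' : Edge 3 L → Fin 3 → ℝ} (hv : v ∈ capBalancedSet L) (hv' : v' ∈ capBalancedSet L) {t : ℝ} (ht : t ≤ 1 / 30)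
    (hvt : ∀ (e : Edge 3 L) (c : Fin 3), |v e c| ≤ t) (hv't : ∀ (e : Edge 3 L) (c : Fin 3), |v' e c| ≤ t) {ρ : ℝ} {g : Site 3 L → SU2} (hg : g ∈ gaugeCore L ρ) :
    Ω (linkEmbed L v) * (W g * Ω (linkEmbed L v')) *
        Real.exp (-(β * ((Fintype.card (Edge 3 L) : ℝ) * (2 * ρ + Real.sqrt 2 * ‖linkEmbed L v‖ + Real.sqrt 2 * ‖linkEmbed L v'‖) ^ 2)) -
          β / 2 * (((10 * Real.sqrt (Fintype.card (Plaquette 3 L × Fin 3)) * ‖linkEmbed L v‖) ^ 2 + stepActionErr (L := L) t 0) +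
            ((10 * Real.sqrt (Fintype.card (Plaquette 3 L × Fin 3)) * ‖linkEmbed L v'‖) ^ 2 + stepActionErr (L := L) t 0))) ≤
      fpTriple L β Ω W 1 1 (v, (v', g)) / transferKernel su2Rep ((L : ℝ) ^ 3 * β) (1 : GaugeConfig 3 1 SU2) 1 := by
  have hK := transferKernel_orthoTube_one_ge hβ hv hv' ht hvt hv't hg
  have hK1 := transferKernel_one_site_one_one_cube (L := L) β
  have hK1p : 0 < transferKernel su2Rep ((L : ℝ) ^ 3 * β) (1 : GaugeConfig 3 1 SU2) 1 := transferKernel_pos _ _ _ _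
  have hratio : Real.exp (-(β * ((Fintype.card (Edge 3 L) : ℝ) * (2 * ρ + Real.sqrt 2 * ‖linkEmbed L v‖ + Real.sqrt 2 * ‖linkEmbed L v'‖) ^ 2)) -
          β / 2 * (((10 * Real.sqrt (Fintype.card (Plaquette 3 L × Fin 3)) * ‖linkEmbed L v‖) ^ 2 + stepActionErr (L := L) t 0) +
            ((10 * Real.sqrt (Fintype.card (Plaquette 3 L × Fin 3)) * ‖linkEmbed L v'‖) ^ 2 + stepActionErr (L := L) t 0))) ≤
      transferKernel su2Rep β (orthoTube L 1 v) (gaugeTransform g (orthoTube L 1 v')) / transferKernel su2Rep ((L : ℝ) ^ 3 * β) (1 : GaugeConfig 3 1 SU2) 1 := by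
    rw [le_div_iff₀ hK1p, hK1, ← Real.exp_add]
    refine (Real.exp_le_exp.mpr (le_of_eq ?_)).trans hK
    ring
  have hF : 0 ≤ Ω (linkEmbed L v) * (W g * Ω (linkEmbed L v')) := mul_nonneg (hΩ0 _) (mul_nonneg (hW0 _) (hΩ0 _))
  unfold fpTriple
  calc Ω (linkEmbed L v) * (W g * Ω (linkEmbed L v')) * Real.exp _ ≤ Ω (linkEmbed L v) * (W g * Ω (linkEmbed L v')) *
        (transferKernel su2Rep β (orthoTube L 1 v) (gaugeTransform g (orthoTube L 1 v')) / transferKernel su2Rep ((L : ℝ) ^ 3 * β) (1 : GaugeConfig 3 1 SU2) 1) :=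
      mul_le_mul_of_nonneg_left hratio hF
    _ = Ω (linkEmbed L v) * (W g * transferKernel su2Rep β (orthoTube L 1 v) (gaugeTransform g (orthoTube L 1 v')) * Ω (linkEmbed L v')) /
        transferKernel su2Rep ((L : ℝ) ^ 3 * β) (1 : GaugeConfig 3 1 SU2) 1 := by ring

/-! ## §3 ★ Upper domination of the diagonal density at a slow datum -/

/-- ★ **`ρ_w ≤ F_w·e^{−β·kinDefect + βE(τ,σ)}`**: at a slow datum `w` with `L³S₁(w) ≤ σ < 2`, balanced capped fibres with `|v_{e,c}|, |v′_{e,c}| ≤ τ ≤ 1/30`, `β ≥ 0`, `Ω, W ≥ 0`: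
`fpTriple β Ω W w w p / K₁^{(L³β)}(w,w) ≤ Ω W Ω·exp(−β·kinDefect (oT w v) (oT w v′) g + β·stepActionErr τ σ)` — the slow magnetic action cancels exactly. [cite: Luscher1983, §3] -/
theorem fpTriple_diag_div_le {β : ℝ} (hβ : 0 ≤ β) {Ω : LinkSpace L → ℝ} (hΩ0 : ∀ x, 0 ≤ Ω x) {W : (Site 3 L → SU2) → ℝ} (hW0 : ∀ g, 0 ≤ W g) (w : GaugeConfig 3 1 SU2)
    {v v' : Edge 3 L → Fin 3 → ℝ} (hv : v ∈ capBalancedSet L) (hv' : v' ∈ capBalancedSet L) {τ σ : ℝ} (hτ : τ ≤ 1 / 30) (hσ : σ < 2)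
    (hS : (L : ℝ) ^ 3 * wilsonAction su2Rep w ≤ σ) (hvτ : ∀ (e : Edge 3 L) (c : Fin 3), |v e c| ≤ τ) (hv'τ : ∀ (e : Edge 3 L) (c : Fin 3), |v' e c| ≤ τ) (g : Site 3 L → SU2) :
    fpTriple L β Ω W w w (v, (v', g)) / transferKernel su2Rep ((L : ℝ) ^ 3 * β) w w ≤
      Ω (linkEmbed L v) * (W g * Ω (linkEmbed L v')) * Real.exp (-(β * kinDefect L (orthoTube L w v) (orthoTube L w v') g) + β * stepActionErr (L := L) τ σ) := by
  have hKw : transferKernel su2Rep ((L : ℝ) ^ 3 * β) w w = Real.exp (β * (2 * (Fintype.card (Edge 3 L) : ℝ)) - β * ((L : ℝ) ^ 3 * wilsonAction su2Rep w)) := by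
    rw [← transferKernel_constLift_self_eq_one_site (L := L) β w, transferKernel_constLift_self]
  have hKwp : 0 < transferKernel su2Rep ((L : ℝ) ^ 3 * β) w w := transferKernel_pos _ _ _ _
  have hSv := wilsonAction_orthoTube_ge (L := L) w hv hτ hσ hS hvτ
  have hSv' := wilsonAction_orthoTube_ge (L := L) w hv' hτ hσ hS hv'τ
  have hσ2 : 0 ≤ 1 - σ / 2 := by linarith
  have hD0 : 0 ≤ (1 - σ / 2) * ‖covCurl (constLift L w) (linkEmbed L v)‖ ^ 2 := mul_nonneg hσ2 (sq_nonneg _)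
  have hD0' : 0 ≤ (1 - σ / 2) * ‖covCurl (constLift L w) (linkEmbed L v')‖ ^ 2 := mul_nonneg hσ2 (sq_nonneg _)
  have hratio : transferKernel su2Rep β (orthoTube L w v) (gaugeTransform g (orthoTube L w v')) / transferKernel su2Rep ((L : ℝ) ^ 3 * β) w w ≤
      Real.exp (-(β * kinDefect L (orthoTube L w v) (orthoTube L w v') g) + β * stepActionErr (L := L) τ σ) := by
    rw [div_le_iff₀ hKwp, hKw, ← Real.exp_add, transferKernel_gaugeTransform_eq]
    refine Real.exp_le_exp.mpr ?_
    have h1 : β / 2 * ((L : ℝ) ^ 3 * wilsonAction su2Rep w + (1 - σ / 2) * ‖covCurl (constLift L w) (linkEmbed L v)‖ ^ 2 - stepActionErr (L := L) τ σ) ≤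
        β / 2 * wilsonAction su2Rep (orthoTube L w v) := mul_le_mul_of_nonneg_left hSv (by positivity)
    have h2 : β / 2 * ((L : ℝ) ^ 3 * wilsonAction su2Rep w + (1 - σ / 2) * ‖covCurl (constLift L w) (linkEmbed L v')‖ ^ 2 - stepActionErr (L := L) τ σ) ≤
        β / 2 * wilsonAction su2Rep (orthoTube L w v') := mul_le_mul_of_nonneg_left hSv' (by positivity)
    have h3 : 0 ≤ β / 2 * ((1 - σ / 2) * ‖covCurl (constLift L w) (linkEmbed L v)‖ ^ 2) := by positivity
    have h4 : 0 ≤ β / 2 * ((1 - σ / 2) * ‖covCurl (constLift L w) (linkEmbed L v')‖ ^ 2) := by positivity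
    nlinarith [h1, h2, h3, h4]
  have hF : 0 ≤ Ω (linkEmbed L v) * (W g * Ω (linkEmbed L v')) := mul_nonneg (hΩ0 _) (mul_nonneg (hW0 _) (hΩ0 _))
  unfold fpTriple
  calc Ω (linkEmbed L v) * (W g * transferKernel su2Rep β (orthoTube L w v) (gaugeTransform g (orthoTube L w v')) * Ω (linkEmbed L v')) /
        transferKernel su2Rep ((L : ℝ) ^ 3 * β) w w =
      Ω (linkEmbed L v) * (W g * Ω (linkEmbed L v')) *
        (transferKernel su2Rep β (orthoTube L w v) (gaugeTransform g (orthoTube L w v')) / transferKernel su2Rep ((L : ℝ) ^ 3 * β) w w) := by ring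
    _ ≤ Ω (linkEmbed L v) * (W g * Ω (linkEmbed L v')) * Real.exp (-(β * kinDefect L (orthoTube L w v) (orthoTube L w v') g) + β * stepActionErr (L := L) τ σ) :=
      mul_le_mul_of_nonneg_left hratio hF

end Summit.QuantumFields.YangMills.Theorems.FemtoTransferGap.RateTube

end
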